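import Literature.Geometry.Kaehler.ComplexTorusAbelianSurfaceShimura
import Literature.Geometry.Kaehler.ComplexTorusMaximalPicardNumberTFAE
import Literature.Geometry.Kaehler.ComplexTorusSimpleIffEndomorphismAlgebra
import HarnessLib

/-!
# An abelian surface with multiplication by a definite quaternion algebra is not simple

[cite: HulekLaface2019PicardNumbersAV, §5.1 Prop. 5.1, exceptional case (1) and its proof]
[cite: Shimura1963AnalyticFamilies, §4 (via Hulek–Laface)]

Hulek–Laface, Prop. 5.1, list Shimura's five exceptional endomorphism structures; the first is
«`F` is of type III, and `m := g/2e = 1`», and «under the assumption that our abelian variety `X` be simple,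
one can show that these cases never occur: `X` is isogenous to a square `Y²`, where `Y` is an abelian
variety of dimension `e₀`, contradicting the fact that `X` is simple».  At `g = 2` (`e = 1`) this is the
classical statement that an abelian surface whose rational endomorphism algebra CONTAINS a definite
quaternion algebra `ℚ⟨A, B⟩`, `A² = a`, `B² = b`, `BA = -AB`, `a, b < 0`, is not simple.  The tree's
`IsSimple.not_isTotallyDefinite_of_finrank_eq_two` (file `ComplexTorusAbelianSurfaceShimura`) is the form
«`End_ℚ(X)` of a simple abelian surface, if a quaternion algebra over its centre, is not totally definite»;
this file deduces the "contains" form, which is the one met in examples (e.g. the tree's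
`not_isAbelianVariety_quaternionPeriod` for ONE torus with definite quaternionic multiplication).

## Main statements

* `not_isSimple_of_definiteQuaternion_mem_endAlgRat` (§2): for a polarised complex torus `X` of dimension `2`
  (`IsRiemannForm Ψ η`, `finrank ℂ E = 2`) and `A, B ∈ End_ℚ(X)` (the matrix model `endAlgRat Ψ`) with
  `A² = a·1`, `B² = b·1`, `BA = -AB`, `a < 0`, `b < 0`: `X` is not simple;
  `IsSimple.not_isAbelianVariety_of_definiteQuaternion_mem_endAlgRat` (a simple `2`-torus with definite
  quaternionic multiplication carries no polarisation); `exists_complexSubtorus_of_definiteQuaternion_mem_endAlgRat`.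
* `finrank_endAlgRat_eq_eight_of_definiteQuaternion_mem_endAlgRat`,
  `exists_isIsogenous_ellipticPow_cm_of_definiteQuaternion_mem_endAlgRat`,
  `finrank_neronSeveriGroup_eq_four_of_definiteQuaternion_mem_endAlgRat` (§3): such an `X` has
  `dim_ℚ End_ℚ(X) = 8`, is isogenous to `E_τ × E_τ` for a CM elliptic curve `E_τ` (Hulek–Laface: «`X` is
  isogenous to a square `Y²`»), and has `ρ(X) = 4`.
* `IsIsogenous.exists_definiteQuaternion_mem_endAlgRat` (§4, the converse: `X ∼ E_τ²` with `E_τ` CM has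
  definite quaternion multiplication, by `diag(√(p² - 4q), -√(p² - 4q))` and `(0 1; -1 0)` in
  `M₂(End_ℚ(E_τ)) ≅ End_ℚ(E_τ²)`), and the characterisation
  `IsRiemannForm.exists_definiteQuaternion_mem_endAlgRat_iff` (definite QM ⟺ `X ∼ E_τ²`, `E_τ` CM)
  with `…_iff_finrank_neronSeveriGroup_eq_four` (⟺ `ρ(X) = 4`) and `…_iff_finrank_endAlgRat_eq_eight`
  (⟺ `dim_ℚ End_ℚ(X) = 8`).

## Proof of §2 (reduction to the tree's Shimura file through Albert's positivity)

Suppose `X` simple; `F = End_ℚ(X)` is a skew field with centre `K`, `[F : K] ∈ {1, 4}`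
(`IsSimple.finrank_endAlgRat_eq_one_or_eq_four`).  `[F : K] = 1` makes `F` commutative, impossible as
`AB = -BA ≠ 0`; so `F` is a quaternion algebra over `K`, and the trichotomy for simple surfaces
(`IsSimple.endAlgRat_trichotomy_of_finrank_eq_two`) gives `K` totally real with `[K : ℚ] = 1`.  The four
elements `1, A, B, AB` are `ℚ`-independent — `x x† = (q₀² - a q₁² - b q₂² + ab q₃²)·1` for
`x = q₀ + q₁A + q₂B + q₃AB`, `x† = q₀ - q₁A - q₂B - q₃AB`, and the form is anisotropic for `a, b < 0` —
hence a `ℚ`-basis of `F` (`dim_ℚ F = [K : ℚ][F : K] = 4`).  `A`, `B`, `AB` are non-central square roots of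
scalars, so their reduced traces vanish (`reducedTrace_eq_zero_of_mul_self_eq`) and the canonical
involution is `x ↦ x†`; therefore `Tr_{K/ℚ} nrd(x) = q₀² - a q₁² - b q₂² + ab q₃² > 0` for `x ≠ 0`, i.e. the
canonical involution is POSITIVE (`isPositiveAntiInvolution_iff_of_forall_eq_standardInvolution`), which
makes `F` totally definite (Lange, Thm. 2.6.5 Step III: `isTotallyDefinite_of_isPositiveAntiInvolution`) —
contradicting `IsSimple.not_isTotallyDefinite_of_finrank_eq_two`.

## Proof of §3–§4

`End_ℚ(X)` is a left module over the skew field `ℚ⟨A, B⟩` (every non-zero `x` has the inverse `x†/N(x)`,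
`qb_isUnit_or_eq_zero`), hence free: `dim_ℚ End_ℚ(X) = 4k` (`qb_finrank_eq_four_mul`); the tree's bound
`dim_ℚ End_ℚ(X) ≤ 2g² = 8` (`finrank_endAlgRat_le_two_mul_sq`) leaves `k ∈ {1, 2}`, and `k = 1` would make
`End_ℚ(X) = ℚ⟨A, B⟩` a skew field, i.e. `X` simple (`IsRiemannForm.isSimple_iff_isUnit_or_eq_zero`) — excluded
by §2.  So `dim_ℚ End_ℚ(X) = 8 = 2g²`, which is the tree's characterisation of `X ∼ E_τ^g` with `E_τ` CM
(`finrank_endAlgRat_eq_two_mul_sq_iff_exists_isIsogenous_ellipticPow_cm`, Beauville's Prop. 3 / Lange's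
Exercise 2.6.3 (2)), and then `ρ(X) = g² = 4` (`finrank_neronSeveriGroup_eq_sq_iff_exists_isIsogenous_ellipticPow_cm`).
Conversely `End_ℚ(E_τ²) ≅ M₂(End_ℚ(E_τ))` (`endAlgRatPowEquiv`) is an isogeny invariant
(`IsIsogenous.nonempty_endAlgRatEquiv`), and for `τ² + pτ + q = 0` the element `w = 2τ + p ∈ End_ℚ(E_τ)`
(`tauMul_mem_endAlgRat`) has `w² = p² - 4q = -4(Im τ)² < 0`.

## References

* [HulekLaface2019PicardNumbersAV] K. Hulek, R. Laface, *On the Picard numbers of abelian varieties*, Ann.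
  Sc. Norm. Super. Pisa Cl. Sci. (5) XIX (2019), §5.1 Prop. 5.1 and proof, case (1).
* [Shimura1963AnalyticFamilies] G. Shimura, *On analytic families of polarized abelian varieties and
  automorphic functions*, Ann. of Math. (2) 78 (1963), 149–192, §4.
* [Lange2023AbelianVarietiesComplex] H. Lange, *Abelian Varieties over the Complex Numbers* (2023), §2.6.2
  Thm. 2.6.5 (Step III of the proof), §2.6.3 Exercise (2), §2.4.4 Cor. 2.4.26, §5.1.5 Exercises (1), (2).
* [Beauville2014MaximalPicard] A. Beauville, *Some surfaces with maximal Picard number*, J. Éc. polytech.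
  Math. 1 (2014), §3 Prop. 3.
-/

noncomputable section

open Module Matrix

namespace Literature.Geometry.Kaehler

namespace ComplexTorus

/-! ## §1 The norm form of a quaternion basis -/

section QuaternionBasis

variable {R : Type*} [Ring R] [Algebra ℚ R] {α β : R} {a b : ℚ}

/-- `A(AB) = aB`. [folklore] -/
private theorem qb_mul_mul (hαα : α * α = a • (1 : R)) : α * (α * β) = a • β := by
  rw [← mul_assoc, hαα, smul_mul_assoc, one_mul]

/-- `(AB)B = bA`. [folklore] -/
private theorem qb_mul_mul' (hββ : β * β = b • (1 : R)) : α * β * β = b • α := by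
  rw [mul_assoc, hββ, mul_smul_comm, mul_one]

/-- `(AB)A = -aB`. [folklore] -/
private theorem qb_mul_mul_left (hαα : α * α = a • (1 : R)) (hβα : β * α = -(α * β)) :
    α * β * α = -(a • β) := by
  rw [mul_assoc, hβα, mul_neg, qb_mul_mul hαα]

/-- `B(AB) = -bA`. [folklore] -/
private theorem qb_mul_mul_right (hββ : β * β = b • (1 : R)) (hβα : β * α = -(α * β)) :
    β * (α * β) = -(b • α) := by
  rw [← mul_assoc, hβα, neg_mul, qb_mul_mul' hββ]

/-- `(AB)² = -ab`. [folklore] -/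
private theorem qb_mul_self (hαα : α * α = a • (1 : R)) (hββ : β * β = b • (1 : R))
    (hβα : β * α = -(α * β)) : α * β * (α * β) = (-(a * b)) • (1 : R) := by
  rw [← mul_assoc, qb_mul_mul_left hαα hβα, neg_mul, smul_mul_assoc, hββ, smul_smul, neg_smul]

/-- **The norm form**: `x x† = (q₀² - a q₁² - b q₂² + ab q₃²)·1` for `x = q₀ + q₁A + q₂B + q₃AB` and
`x† = q₀ - q₁A - q₂B - q₃AB`. [folklore] -/
private theorem qb_mul_conj (hαα : α * α = a • (1 : R)) (hββ : β * β = b • (1 : R))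
    (hβα : β * α = -(α * β)) (q₀ q₁ q₂ q₃ : ℚ) :
    (q₀ • (1 : R) + q₁ • α + q₂ • β + q₃ • (α * β)) *
        (q₀ • (1 : R) + q₁ • -α + q₂ • -β + q₃ • -(α * β)) =
      (q₀ ^ 2 - a * q₁ ^ 2 - b * q₂ ^ 2 + a * b * q₃ ^ 2) • (1 : R) := by
  simp only [mul_add, add_mul, smul_mul_assoc, mul_smul_comm, mul_neg, smul_neg, mul_one, one_mul, hαα, hββ,
    hβα, qb_mul_mul hαα, qb_mul_mul' hββ, qb_mul_mul_left hαα hβα, qb_mul_mul_right hββ hβα,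
    qb_mul_self hαα hββ hβα, smul_smul]
  module

/-- The norm form `q₀² - a q₁² - b q₂² + ab q₃²` is positive definite for `a, b < 0`. [folklore] -/
private theorem qb_norm_pos (ha : a < 0) (hb : b < 0) {q₀ q₁ q₂ q₃ : ℚ}
    (h : ¬ (q₀ = 0 ∧ q₁ = 0 ∧ q₂ = 0 ∧ q₃ = 0)) :
    0 < q₀ ^ 2 - a * q₁ ^ 2 - b * q₂ ^ 2 + a * b * q₃ ^ 2 := by
  have hab : 0 < a * b := mul_pos_of_neg_of_neg ha hb
  have h0 := sq_nonneg q₀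
  have h1 : 0 ≤ -a * q₁ ^ 2 := mul_nonneg (by linarith) (sq_nonneg _)
  have h2 : 0 ≤ -b * q₂ ^ 2 := mul_nonneg (by linarith) (sq_nonneg _)
  have h3 : 0 ≤ a * b * q₃ ^ 2 := mul_nonneg hab.le (sq_nonneg _)
  have hne : q₀ ≠ 0 ∨ q₁ ≠ 0 ∨ q₂ ≠ 0 ∨ q₃ ≠ 0 := by tauto
  rcases hne with hq | hq | hq | hq
  · have := pow_pos (abs_pos.2 hq) 2
    rw [pow_abs, abs_eq_self.2 (sq_nonneg q₀)] at this
    linarith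
  · have : 0 < -a * q₁ ^ 2 := mul_pos (by linarith) (by positivity)
    linarith
  · have : 0 < -b * q₂ ^ 2 := mul_pos (by linarith) (by positivity)
    linarith
  · have : 0 < a * b * q₃ ^ 2 := mul_pos hab (by positivity)
    linarith

/-- `x = -x ⇒ x = 0` in a `ℚ`-vector space. [folklore] -/
private theorem eq_zero_of_eq_neg_self' {M : Type*} [AddCommGroup M] [Module ℚ M] {x : M} (h : x = -x) :
    x = 0 := by
  have h2 : (2 : ℚ) • x = 0 := by rw [two_smul, ← eq_neg_iff_add_eq_zero]; exact h
  exact (smul_eq_zero.1 h2).resolve_left two_ne_zero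

end QuaternionBasis

/-! ## §2 The theorem -/

section Surface

open Literature.RingTheory.CentralSimple Literature.NumberTheory.Automorphic NumberField

variable {κ : Type} [Fintype κ] [DecidableEq κ] [Nonempty κ] {E : Type*} [NormedAddCommGroup E]
  [NormedSpace ℂ E] [FiniteDimensional ℂ E] {Ψ : (κ → ℝ) ≃L[ℝ] E} {η : E [⋀^Fin 2]→L[ℝ] ℝ}

omit [FiniteDimensional ℂ E] in
/-- `ℚ ⊆ K ⊆ End_ℚ(X)` is a scalar tower. [folklore] -/
private theorem isScalarTower_ratQ (hX : IsSimple Ψ) :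
    IsScalarTower ℚ (centerField Ψ hX) (endAlgRat Ψ) :=
  IsScalarTower.of_algebraMap_smul fun q x ↦ by
    rw [Algebra.smul_def, Algebra.algebraMap_eq_smul_one q,
      map_rat_smul (algebraMap (centerField Ψ hX) (endAlgRat Ψ)) q 1, map_one, smul_mul_assoc, one_mul]

omit [FiniteDimensional ℂ E] in
/-- `End_ℚ(X)` is a non-trivial ring (`κ` non-empty). [folklore] -/
private theorem nontrivial_endAlgRatQ (Ψ : (κ → ℝ) ≃L[ℝ] E) : Nontrivial (endAlgRat Ψ) :=
  ⟨⟨0, 1, fun h ↦ zero_ne_one (congrArg Subtype.val h)⟩⟩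

/-- **Shimura's exceptional case (1) at `g = 2`, "contains" form: an abelian surface with multiplication by
a definite quaternion algebra is not simple.**  For a polarised complex torus `X` of dimension `2` and
`A, B ∈ End_ℚ(X)` with `A² = a·1`, `B² = b·1`, `BA = -AB`, `a < 0`, `b < 0` (so `ℚ⟨A, B⟩ ⊆ End_ℚ(X)` is the
definite quaternion algebra `(a, b / ℚ)`), `X` is NOT simple (Hulek–Laface: «`F` is of type III, and
`m := g/2e = 1` […] under the assumption that our abelian variety `X` be simple, one can show that these
cases never occur»).  Proof: were `X` simple, `End_ℚ(X) = ℚ⟨A, B⟩` would be a quaternion algebra over `K = ℚ`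
whose canonical involution `q₀ + q₁A + q₂B + q₃AB ↦ q₀ - q₁A - q₂B - q₃AB` is positive
(`nrd = q₀² - a q₁² - b q₂² + ab q₃²`), hence totally definite (Lange, Thm. 2.6.5, Step III) — excluded by
`IsSimple.not_isTotallyDefinite_of_finrank_eq_two`.
[cite: HulekLaface2019PicardNumbersAV, §5.1 Prop. 5.1, exceptional case (1) and its proof]
[cite: Shimura1963AnalyticFamilies, §4 (via Hulek–Laface)]
[cite: Lange2023AbelianVarietiesComplex, §2.6.2 Thm. 2.6.5, proof, Step III] -/
theorem not_isSimple_of_definiteQuaternion_mem_endAlgRat (hη : IsRiemannForm Ψ η) (hg : finrank ℂ E = 2)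
    {A B : Matrix κ κ ℚ} (hA : A ∈ endAlgRat Ψ) (hB : B ∈ endAlgRat Ψ) {a b : ℚ} (ha : a < 0)
    (hb : b < 0) (hAA : A * A = a • (1 : Matrix κ κ ℚ)) (hBB : B * B = b • (1 : Matrix κ κ ℚ))
    (hBA : B * A = -(A * B)) : ¬ IsSimple Ψ := by
  intro hX
  haveI := isScalarTower_ratQ hX
  haveI := nontrivial_endAlgRatQ Ψ
  -- §0: `B ≠ 0`, `AB ≠ BA`, `A(AB) ≠ (AB)A` at matrix level
  have hB0 : B ≠ 0 := by
    rintro rfl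
    obtain ⟨i⟩ := (inferInstance : Nonempty κ)
    have h := congrFun (congrFun hBB i) i
    simp at h
    exact hb.ne h.symm
  have hAB0 : A * B ≠ 0 := by
    intro h
    apply hB0
    have : a • B = 0 := by rw [← one_mul B, ← smul_mul_assoc, ← hAA, mul_assoc, h, mul_zero]
    exact (smul_eq_zero.1 this).resolve_left ha.ne
  have hcomm : A * B ≠ B * A := by
    intro h
    rw [hBA] at h
    exact hAB0 (eq_zero_of_eq_neg_self' h)
  have hcomm' : A * B * A ≠ A * (A * B) := by
    intro h
    rw [mul_assoc, hBA, mul_neg] at h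
    have h0 : A * (A * B) = 0 := eq_zero_of_eq_neg_self' h.symm
    apply hB0
    have : a • B = 0 := by rw [← one_mul B, ← smul_mul_assoc, ← hAA, mul_assoc, h0]
    exact (smul_eq_zero.1 this).resolve_left ha.ne
  -- §1: the elements of `F = End_ℚ(X)`
  set α : endAlgRat Ψ := ⟨A, hA⟩ with hαdef
  set β : endAlgRat Ψ := ⟨B, hB⟩ with hβdef
  have hαα : α * α = a • (1 : endAlgRat Ψ) := Subtype.ext hAA
  have hββ : β * β = b • (1 : endAlgRat Ψ) := Subtype.ext hBB
  have hβα : β * α = -(α * β) := Subtype.ext hBA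
  -- §2: `[F : K] = 4`, `F` a quaternion algebra over a totally real `K` with `[K : ℚ] = 1`
  have h4 : finrank (centerField Ψ hX) (endAlgRat Ψ) = 4 := by
    rcases hX.finrank_endAlgRat_eq_one_or_eq_four hg.le with h1 | h4
    · exact absurd (congrArg Subtype.val (hX.mul_comm_of_finrank_eq_one h1 α β)) hcomm
    · exact h4
  haveI := hX.isQuaternionAlgebra_of_finrank_eq_four h4
  obtain ⟨hK, he⟩ : IsTotallyReal (centerField Ψ hX) ∧ finrank ℚ (centerField Ψ hX) = 1 := by
    rcases hX.endAlgRat_trichotomy_of_finrank_eq_two hη hg with ⟨_, h1, _⟩ | ⟨hK, he, _, _⟩ | ⟨_, h1, _⟩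
    · omega
    · exact ⟨hK, he⟩
    · omega
  haveI := hK
  have hdim : finrank ℚ (endAlgRat Ψ) = 4 := by
    rw [← Module.finrank_mul_finrank ℚ (centerField Ψ hX) (endAlgRat Ψ), he, h4]
  -- §3: `1, A, B, AB` is a `ℚ`-basis of `F`
  have hN0 : ∀ {q₀ q₁ q₂ q₃ : ℚ}, q₀ • (1 : endAlgRat Ψ) + q₁ • α + q₂ • β + q₃ • (α * β) = 0 →
      q₀ = 0 ∧ q₁ = 0 ∧ q₂ = 0 ∧ q₃ = 0 := by
    intro q₀ q₁ q₂ q₃ h0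
    have hN := qb_mul_conj hαα hββ hβα q₀ q₁ q₂ q₃
    rw [h0, zero_mul] at hN
    by_contra hne
    exact one_ne_zero ((smul_eq_zero.1 hN.symm).resolve_left (qb_norm_pos ha hb hne).ne')
  have hli : LinearIndependent ℚ ![(1 : endAlgRat Ψ), α, β, α * β] := by
    rw [Fintype.linearIndependent_iff]
    intro g hg0 i
    simp only [Fin.sum_univ_four, Matrix.cons_val_zero, Matrix.cons_val_one, Matrix.cons_val] at hg0
    obtain ⟨h0, h1, h2, h3⟩ := hN0 hg0
    fin_cases i <;> assumption
  have hspan : Submodule.span ℚ (Set.range ![(1 : endAlgRat Ψ), α, β, α * β]) = ⊤ := by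
    apply Submodule.eq_top_of_finrank_eq
    rw [finrank_span_eq_card hli, Fintype.card_fin, hdim]
  have hcoord : ∀ x : endAlgRat Ψ, ∃ c : Fin 4 → ℚ,
      c 0 • (1 : endAlgRat Ψ) + c 1 • α + c 2 • β + c 3 • (α * β) = x := fun x ↦ by
    have hx : x ∈ Submodule.span ℚ (Set.range ![(1 : endAlgRat Ψ), α, β, α * β]) := by
      rw [hspan]; exact Submodule.mem_top
    obtain ⟨c, hc⟩ := (Submodule.mem_span_range_iff_exists_fun ℚ).1 hx
    refine ⟨c, ?_⟩
    simpa only [Fin.sum_univ_four, Matrix.cons_val_zero, Matrix.cons_val_one, Matrix.cons_val] using hc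
  -- §4: the canonical involution is `q₀ + q₁A + q₂B + q₃AB ↦ q₀ - q₁A - q₂B - q₃AB`
  have hsq : ∀ q : ℚ, q • (1 : endAlgRat Ψ) =
      algebraMap (centerField Ψ hX) (endAlgRat Ψ) (algebraMap ℚ (centerField Ψ hX) q) := fun q ↦ by
    rw [← IsScalarTower.algebraMap_apply, Algebra.algebraMap_eq_smul_one]
  have hnotcentral : ∀ {x : endAlgRat Ψ} (y : endAlgRat Ψ), (x * y : Matrix κ κ ℚ) ≠ y * x →
      x ∉ (⊥ : Subalgebra (centerField Ψ hX) (endAlgRat Ψ)) := by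
    intro x y hxy hx
    obtain ⟨k, hk⟩ := Algebra.mem_bot.1 hx
    apply hxy
    have h := Algebra.commutes k y
    rw [hk] at h
    exact congrArg Subtype.val h
  have hαK := hnotcentral (x := α) β hcomm
  have hβK := hnotcentral (x := β) α (by simpa [hαdef, hβdef] using hcomm.symm)
  have hαβK := hnotcentral (x := α * β) α (by simpa [hαdef, hβdef] using hcomm')
  have htα : reducedTrace (centerField Ψ hX) (endAlgRat Ψ) α = 0 :=
    reducedTrace_eq_zero_of_mul_self_eq (centerField Ψ hX) (endAlgRat Ψ) (hαα.trans (hsq a)) hαK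
  have htβ : reducedTrace (centerField Ψ hX) (endAlgRat Ψ) β = 0 :=
    reducedTrace_eq_zero_of_mul_self_eq (centerField Ψ hX) (endAlgRat Ψ) (hββ.trans (hsq b)) hβK
  have htαβ : reducedTrace (centerField Ψ hX) (endAlgRat Ψ) (α * β) = 0 :=
    reducedTrace_eq_zero_of_mul_self_eq (centerField Ψ hX) (endAlgRat Ψ)
      ((qb_mul_self hαα hββ hβα).trans (hsq _)) hαβK
  have hι : ∀ {x : endAlgRat Ψ}, reducedTrace (centerField Ψ hX) (endAlgRat Ψ) x = 0 →
      standardInvolution (centerField Ψ hX) (endAlgRat Ψ) x = -x := fun {x} hx ↦ by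
    rw [standardInvolution_def, hx, map_zero, zero_sub]
  have hιsmul : ∀ (q : ℚ) (x : endAlgRat Ψ), standardInvolution (centerField Ψ hX) (endAlgRat Ψ) (q • x) =
      q • standardInvolution (centerField Ψ hX) (endAlgRat Ψ) x := fun q x ↦ by
    rw [← algebraMap_smul (centerField Ψ hX) q x, standardInvolution_smul, algebraMap_smul]
  -- §5: `Tr_{K/ℚ} nrd(x) = q₀² - a q₁² - b q₂² + ab q₃² > 0` for `x ≠ 0`
  have hpos : ∀ x : endAlgRat Ψ, x ≠ 0 →
      0 < Algebra.trace ℚ (centerField Ψ hX) (reducedNorm (centerField Ψ hX) (endAlgRat Ψ) x) := by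
    intro x hx
    obtain ⟨c, hc⟩ := hcoord x
    have hxbar : standardInvolution (centerField Ψ hX) (endAlgRat Ψ) x =
        c 0 • (1 : endAlgRat Ψ) + c 1 • -α + c 2 • -β + c 3 • -(α * β) := by
      rw [← hc, standardInvolution_add, standardInvolution_add, standardInvolution_add, hιsmul, hιsmul,
        hιsmul, hιsmul, standardInvolution_one, hι htα, hι htβ, hι htαβ]
    have hxx : x * standardInvolution (centerField Ψ hX) (endAlgRat Ψ) x =
        algebraMap (centerField Ψ hX) (endAlgRat Ψ) (algebraMap ℚ (centerField Ψ hX)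
          (c 0 ^ 2 - a * c 1 ^ 2 - b * c 2 ^ 2 + a * b * c 3 ^ 2)) := by
      rw [hxbar, ← hsq]
      nth_rewrite 1 [← hc]
      exact qb_mul_conj hαα hββ hβα _ _ _ _
    have hnrd := reducedNorm_eq_of_mul_standardInvolution_eq h4 hxx
    have hne : ¬ (c 0 = 0 ∧ c 1 = 0 ∧ c 2 = 0 ∧ c 3 = 0) := by
      rintro ⟨h0, h1, h2, h3⟩
      apply hx
      rw [← hc, h0, h1, h2, h3]
      simp
    rw [hnrd, Algebra.trace_algebraMap, he, one_smul]
    exact qb_norm_pos ha hb hne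
  -- §6: the canonical involution is positive, so `F` is totally definite — excluded by Shimura
  have hpos' := (isPositiveAntiInvolution_iff_of_forall_eq_standardInvolution (centerField Ψ hX)
    (ι := (canonicalInvolution (centerField Ψ hX) (endAlgRat Ψ)).restrictScalars ℚ) (fun _ ↦ rfl)).2 hpos
  exact hX.not_isTotallyDefinite_of_finrank_eq_two hη hg
    (isTotallyDefinite_of_isPositiveAntiInvolution (centerField Ψ hX) (fun _ ↦ rfl) hpos')

/-- **A simple complex `2`-torus with definite quaternionic multiplication is not algebraic** (the
contrapositive: no polarisation exists; the tree's `not_isAbelianVariety_quaternionPeriod` is the instance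
`a = -1/2`, `b = -1/4` of Lange's Exercise 1.1.6 (2)(c)).
[cite: HulekLaface2019PicardNumbersAV, §5.1 Prop. 5.1, exceptional case (1) and its proof]
[cite: Shimura1963AnalyticFamilies, §4 (via Hulek–Laface)] -/
theorem IsSimple.not_isAbelianVariety_of_definiteQuaternion_mem_endAlgRat (hX : IsSimple Ψ)
    (hg : finrank ℂ E = 2) {A B : Matrix κ κ ℚ} (hA : A ∈ endAlgRat Ψ) (hB : B ∈ endAlgRat Ψ) {a b : ℚ}
    (ha : a < 0) (hb : b < 0) (hAA : A * A = a • (1 : Matrix κ κ ℚ)) (hBB : B * B = b • (1 : Matrix κ κ ℚ))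
    (hBA : B * A = -(A * B)) : ¬ IsAbelianVariety Ψ := fun ⟨_, hη⟩ ↦
  not_isSimple_of_definiteQuaternion_mem_endAlgRat hη hg hA hB ha hb hAA hBB hBA hX

/-- **Corollary: such an abelian surface contains a non-trivial proper complex subtorus** (an elliptic
curve): some lattice subspace `V`, `0 ≠ V ≠ ℝ^κ`, is stable under the complex structure (Hulek–Laface, case
(1): «`X` is isogenous to a square `Y²`» — only the existence of a proper subtorus is recorded here).
[cite: HulekLaface2019PicardNumbersAV, §5.1 Prop. 5.1, proof of case (1)] -/
theorem exists_complexSubtorus_of_definiteQuaternion_mem_endAlgRat (hη : IsRiemannForm Ψ η)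
    (hg : finrank ℂ E = 2) {A B : Matrix κ κ ℚ} (hA : A ∈ endAlgRat Ψ) (hB : B ∈ endAlgRat Ψ) {a b : ℚ}
    (ha : a < 0) (hb : b < 0) (hAA : A * A = a • (1 : Matrix κ κ ℚ)) (hBB : B * B = b • (1 : Matrix κ κ ℚ))
    (hBA : B * A = -(A * B)) :
    ∃ V : Submodule ℝ (κ → ℝ), IsLatticeSubspace V ∧ IsComplexSubspace Ψ V ∧ V ≠ ⊥ ∧ V ≠ ⊤ := by
  have h := not_isSimple_of_definiteQuaternion_mem_endAlgRat hη hg hA hB ha hb hAA hBB hBA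
  simp only [IsSimple, not_forall, not_or] at h
  obtain ⟨V, hL, hC, h1, h2⟩ := h
  exact ⟨V, hL, hC, h1, h2⟩

end Surface

/-! ## §3 Structure: such a surface is isogenous to the square of a CM elliptic curve -/

section QuaternionSubalgebra

variable {R : Type*} [Ring R] [Algebra ℚ R] {α β : R} {a b : ℚ}

/-- **The multiplication table** of `ℚ⟨A, B⟩`: `(p₀ + p₁A + p₂B + p₃AB)(q₀ + q₁A + q₂B + q₃AB) = r₀ + r₁A + r₂B + r₃AB`
with the quaternion product `r` of `(a, b / ℚ)`. [folklore] -/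
private theorem qb_mul (hαα : α * α = a • (1 : R)) (hββ : β * β = b • (1 : R))
    (hβα : β * α = -(α * β)) (p₀ p₁ p₂ p₃ q₀ q₁ q₂ q₃ : ℚ) :
    (p₀ • (1 : R) + p₁ • α + p₂ • β + p₃ • (α * β)) * (q₀ • (1 : R) + q₁ • α + q₂ • β + q₃ • (α * β)) =
      (p₀ * q₀ + a * p₁ * q₁ + b * p₂ * q₂ - a * b * p₃ * q₃) • (1 : R) +
        (p₀ * q₁ + p₁ * q₀ - b * p₂ * q₃ + b * p₃ * q₂) • α +
        (p₀ * q₂ + p₂ * q₀ + a * p₁ * q₃ - a * p₃ * q₁) • β +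
        (p₀ * q₃ + p₃ * q₀ + p₁ * q₂ - p₂ * q₁) • (α * β) := by
  simp only [mul_add, add_mul, smul_mul_assoc, mul_smul_comm, mul_one, one_mul, hαα, hββ, hβα,
    qb_mul_mul hαα, qb_mul_mul' hββ, qb_mul_mul_left hαα hβα, qb_mul_mul_right hββ hβα,
    qb_mul_self hαα hββ hβα, smul_neg, smul_smul]
  module

/-- `x† x = (q₀² - a q₁² - b q₂² + ab q₃²)·1` (the norm form from the other side). [folklore] -/
private theorem qb_conj_mul (hαα : α * α = a • (1 : R)) (hββ : β * β = b • (1 : R))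
    (hβα : β * α = -(α * β)) (q₀ q₁ q₂ q₃ : ℚ) :
    (q₀ • (1 : R) + q₁ • -α + q₂ • -β + q₃ • -(α * β)) *
        (q₀ • (1 : R) + q₁ • α + q₂ • β + q₃ • (α * β)) =
      (q₀ ^ 2 - a * q₁ ^ 2 - b * q₂ ^ 2 + a * b * q₃ ^ 2) • (1 : R) := by
  simp only [mul_add, add_mul, smul_mul_assoc, mul_smul_comm, neg_mul, smul_neg, mul_one, one_mul, hαα, hββ,
    hβα, qb_mul_mul hαα, qb_mul_mul' hββ, qb_mul_mul_left hαα hβα, qb_mul_mul_right hββ hβα,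
    qb_mul_self hαα hββ hβα, neg_neg, smul_smul]
  module

/-- `1, A, B, AB` are linearly independent over `ℚ` when `a, b < 0` (the norm form is anisotropic).
[folklore] -/
private theorem qb_linearIndependent [Nontrivial R] (hαα : α * α = a • (1 : R)) (hββ : β * β = b • (1 : R))
    (hβα : β * α = -(α * β)) (ha : a < 0) (hb : b < 0) : LinearIndependent ℚ ![(1 : R), α, β, α * β] := by
  rw [Fintype.linearIndependent_iff]
  intro g hg0 i
  simp only [Fin.sum_univ_four, Matrix.cons_val_zero, Matrix.cons_val_one, Matrix.cons_val] at hg0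
  have hN := qb_mul_conj hαα hββ hβα (g 0) (g 1) (g 2) (g 3)
  rw [hg0, zero_mul] at hN
  have hall : g 0 = 0 ∧ g 1 = 0 ∧ g 2 = 0 ∧ g 3 = 0 := by
    by_contra hne
    exact one_ne_zero ((smul_eq_zero.1 hN.symm).resolve_left (qb_norm_pos ha hb hne).ne')
  obtain ⟨h0, h1, h2, h3⟩ := hall
  fin_cases i <;> assumption

/-- Membership in the span of `1, A, B, AB` is having coordinates. [folklore] -/
private theorem mem_qbSpan_iff {x : R} :
    x ∈ Submodule.span ℚ (Set.range ![(1 : R), α, β, α * β]) ↔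
      ∃ c : Fin 4 → ℚ, c 0 • (1 : R) + c 1 • α + c 2 • β + c 3 • (α * β) = x := by
  rw [Submodule.mem_span_range_iff_exists_fun]
  simp only [Fin.sum_univ_four, Matrix.cons_val_zero, Matrix.cons_val_one, Matrix.cons_val]

/-- The span of `1, A, B, AB` is closed under multiplication. [folklore] -/
private theorem qbSpan_mul_mem (hαα : α * α = a • (1 : R)) (hββ : β * β = b • (1 : R))
    (hβα : β * α = -(α * β)) {x y : R} (hx : x ∈ Submodule.span ℚ (Set.range ![(1 : R), α, β, α * β]))
    (hy : y ∈ Submodule.span ℚ (Set.range ![(1 : R), α, β, α * β])) :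
    x * y ∈ Submodule.span ℚ (Set.range ![(1 : R), α, β, α * β]) := by
  obtain ⟨p, rfl⟩ := mem_qbSpan_iff.1 hx
  obtain ⟨q, rfl⟩ := mem_qbSpan_iff.1 hy
  rw [qb_mul hαα hββ hβα]
  exact mem_qbSpan_iff.2 ⟨![_, _, _, _], rfl⟩

/-- **`ℚ⟨A, B⟩` is a division algebra for `a, b < 0`**: in the subalgebra with underlying space the span of
`1, A, B, AB`, every non-zero element is a unit (`x⁻¹ = x†/N(x)`). [folklore] -/
private theorem qb_isUnit_or_eq_zero [Nontrivial R] (hαα : α * α = a • (1 : R)) (hββ : β * β = b • (1 : R))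
    (hβα : β * α = -(α * β)) (ha : a < 0) (hb : b < 0) {S : Subalgebra ℚ R}
    (hS : Subalgebra.toSubmodule S = Submodule.span ℚ (Set.range ![(1 : R), α, β, α * β])) (x : S) :
    IsUnit x ∨ x = 0 := by
  by_cases hx : x = 0
  · exact Or.inr hx
  left
  have hxS : (x : R) ∈ Submodule.span ℚ (Set.range ![(1 : R), α, β, α * β]) := by
    rw [← hS]; exact x.2
  obtain ⟨c, hc⟩ := mem_qbSpan_iff.1 hxS
  have hne : ¬ (c 0 = 0 ∧ c 1 = 0 ∧ c 2 = 0 ∧ c 3 = 0) := by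
    rintro ⟨h0, h1, h2, h3⟩
    apply hx
    apply Subtype.ext
    rw [Subalgebra.coe_zero, ← hc, h0, h1, h2, h3]
    simp
  set N : ℚ := c 0 ^ 2 - a * c 1 ^ 2 - b * c 2 ^ 2 + a * b * c 3 ^ 2 with hNdef
  have hN : N ≠ 0 := (qb_norm_pos ha hb hne).ne'
  -- the inverse `x† / N`
  set y : R := N⁻¹ • (c 0 • (1 : R) + c 1 • -α + c 2 • -β + c 3 • -(α * β)) with hydef
  have hyS : y ∈ S := by
    rw [← Subalgebra.mem_toSubmodule, hS]
    refine Submodule.smul_mem _ _ (mem_qbSpan_iff.2 ⟨![c 0, -c 1, -c 2, -c 3], ?_⟩)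
    simp [neg_smul, smul_neg]
  have hxy : (x : R) * y = 1 := by
    rw [hydef, mul_smul_comm, ← hc, qb_mul_conj hαα hββ hβα, smul_smul, inv_mul_cancel₀ hN, one_smul]
  have hyx : y * (x : R) = 1 := by
    rw [hydef, smul_mul_assoc, ← hc, qb_conj_mul hαα hββ hβα, smul_smul, inv_mul_cancel₀ hN, one_smul]
  exact ⟨⟨x, ⟨y, hyS⟩, Subtype.ext hxy, Subtype.ext hyx⟩, rfl⟩

/-- **`dim_ℚ R = 4 · dim_{ℚ⟨A,B⟩} R`**: a `ℚ`-algebra containing a copy of the definite quaternion algebra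
`(a, b / ℚ)` is a free left module over it, so its dimension is a multiple of `4`. [folklore] -/
private theorem qb_finrank_eq_four_mul [Nontrivial R] (hαα : α * α = a • (1 : R)) (hββ : β * β = b • (1 : R))
    (hβα : β * α = -(α * β)) (ha : a < 0) (hb : b < 0) {S : Subalgebra ℚ R}
    (hS : Subalgebra.toSubmodule S = Submodule.span ℚ (Set.range ![(1 : R), α, β, α * β])) :
    ∃ k : ℕ, finrank ℚ R = 4 * k := by
  letI : DivisionRing S := DivisionRing.ofIsUnitOrEqZero (qb_isUnit_or_eq_zero hαα hββ hβα ha hb hS)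
  have h4 : finrank ℚ S = 4 := by
    rw [← Subalgebra.finrank_toSubmodule, hS, finrank_span_eq_card (qb_linearIndependent hαα hββ hβα ha hb),
      Fintype.card_fin]
  exact ⟨finrank S R, by rw [← Module.finrank_mul_finrank ℚ S R, h4]⟩

end QuaternionSubalgebra

section Structure

open Literature.RingTheory.CentralSimple Literature.NumberTheory.Automorphic NumberField

variable {κ : Type} [Fintype κ] [DecidableEq κ] [Nonempty κ] {E : Type*} [NormedAddCommGroup E]
  [NormedSpace ℂ E] [FiniteDimensional ℂ E] {Ψ : (κ → ℝ) ≃L[ℝ] E} {η : E [⋀^Fin 2]→L[ℝ] ℝ}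

/-- **`dim_ℚ End_ℚ(X) = 8` for an abelian surface with definite quaternion multiplication.**
`End_ℚ(X)` is a free left `ℚ⟨A, B⟩`-module, so `4 ∣ dim_ℚ End_ℚ(X) ≤ 2g² = 8`; `dim = 4` would make
`End_ℚ(X) = ℚ⟨A, B⟩` a skew field and `X` simple (`IsRiemannForm.isSimple_iff_isUnit_or_eq_zero`), excluded by
`not_isSimple_of_definiteQuaternion_mem_endAlgRat`. (Hulek–Laface, case (1): «`X` is isogenous to a square
`Y²`»; with `End_ℚ(E²) = M₂(K)`, `K` imaginary quadratic, of dimension `8`.)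
[cite: HulekLaface2019PicardNumbersAV, §5.1 Prop. 5.1, proof of case (1)]
[cite: Lange2023AbelianVarietiesComplex, §5.1.5 Exercise (2)(a)(ii) (`End_ℚ(E₁ × E₂) ≃ M₂(End_ℚ(E₁))`)] -/
theorem finrank_endAlgRat_eq_eight_of_definiteQuaternion_mem_endAlgRat (hη : IsRiemannForm Ψ η)
    (hg : finrank ℂ E = 2) {A B : Matrix κ κ ℚ} (hA : A ∈ endAlgRat Ψ) (hB : B ∈ endAlgRat Ψ) {a b : ℚ}
    (ha : a < 0) (hb : b < 0) (hAA : A * A = a • (1 : Matrix κ κ ℚ)) (hBB : B * B = b • (1 : Matrix κ κ ℚ))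
    (hBA : B * A = -(A * B)) : finrank ℚ (endAlgRat Ψ) = 8 := by
  haveI := nontrivial_endAlgRatQ Ψ
  set α : endAlgRat Ψ := ⟨A, hA⟩ with hαdef
  set β : endAlgRat Ψ := ⟨B, hB⟩ with hβdef
  have hαα : α * α = a • (1 : endAlgRat Ψ) := Subtype.ext hAA
  have hββ : β * β = b • (1 : endAlgRat Ψ) := Subtype.ext hBB
  have hβα : β * α = -(α * β) := Subtype.ext hBA
  -- the subalgebra `ℚ⟨A, B⟩ ⊆ End_ℚ(X)`
  let P : Submodule ℚ (endAlgRat Ψ) := Submodule.span ℚ (Set.range ![(1 : endAlgRat Ψ), α, β, α * β])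
  have hP1 : (1 : endAlgRat Ψ) ∈ P := Submodule.subset_span ⟨0, rfl⟩
  let S : Subalgebra ℚ (endAlgRat Ψ) := P.toSubalgebra hP1 (fun x y ↦ qbSpan_mul_mem hαα hββ hβα)
  have hS : Subalgebra.toSubmodule S = P := Submodule.toSubalgebra_toSubmodule P _ _
  obtain ⟨k, hk⟩ := qb_finrank_eq_four_mul hαα hββ hβα ha hb hS
  have hle : finrank ℚ (endAlgRat Ψ) ≤ 8 := by simpa [hg] using finrank_endAlgRat_le_two_mul_sq Ψ
  have h4 : finrank ℚ P = 4 := by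
    rw [finrank_span_eq_card (qb_linearIndependent hαα hββ hβα ha hb), Fintype.card_fin]
  have hge : 4 ≤ finrank ℚ (endAlgRat Ψ) := h4 ▸ P.finrank_le
  have hk12 : k = 1 ∨ k = 2 := by omega
  rcases hk12 with rfl | rfl
  · -- `End_ℚ(X) = ℚ⟨A, B⟩` is a skew field: `X` would be simple
    exfalso
    have hPtop : P = ⊤ := Submodule.eq_top_of_finrank_eq (by rw [h4, hk])
    refine not_isSimple_of_definiteQuaternion_mem_endAlgRat hη hg hA hB ha hb hAA hBB hBA
      (hη.isSimple_iff_isUnit_or_eq_zero.2 fun x ↦ ?_)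
    have hxS : x ∈ S := by rw [← Subalgebra.mem_toSubmodule, hS, hPtop]; exact Submodule.mem_top
    rcases qb_isUnit_or_eq_zero hαα hββ hβα ha hb hS ⟨x, hxS⟩ with hu | h0
    · exact Or.inl (hu.map S.val)
    · exact Or.inr (congrArg Subtype.val h0)
  · omega

/-- **An abelian surface with definite quaternion multiplication is isogenous to the square `E_τ × E_τ` of an
elliptic curve with complex multiplication** (`End(E_τ) ≠ ℤ`) — Hulek–Laface's mechanism for case (1): «`X`
is isogenous to a square `Y²`, where `Y` is an abelian variety of dimension `e₀`» (`e₀ = 1`), via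
`dim_ℚ End_ℚ(X) = 8 = 2g²` and Beauville's Prop. 3 / Lange's Exercise 2.6.3 (2)
(`finrank_endAlgRat_eq_two_mul_sq_iff_exists_isIsogenous_ellipticPow_cm`).
[cite: HulekLaface2019PicardNumbersAV, §5.1 Prop. 5.1, proof of case (1)]
[cite: Shimura1963AnalyticFamilies, §4 (via Hulek–Laface)]
[cite: Lange2023AbelianVarietiesComplex, §2.6.3 Exercise (2) (ii)] -/
theorem exists_isIsogenous_ellipticPow_cm_of_definiteQuaternion_mem_endAlgRat (hη : IsRiemannForm Ψ η)
    (hg : finrank ℂ E = 2) {A B : Matrix κ κ ℚ} (hA : A ∈ endAlgRat Ψ) (hB : B ∈ endAlgRat Ψ) {a b : ℚ}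
    (ha : a < 0) (hb : b < 0) (hAA : A * A = a • (1 : Matrix κ κ ℚ)) (hBB : B * B = b • (1 : Matrix κ κ ℚ))
    (hBA : B * A = -(A * B)) :
    ∃ τ : ℂ, ∃ hτ : τ.im ≠ 0, ellipticEnd hτ ≠ ⊥ ∧ IsIsogenous Ψ (powPeriod (ellipticPeriod hτ) 2) := by
  have h8 := finrank_endAlgRat_eq_eight_of_definiteQuaternion_mem_endAlgRat hη hg hA hB ha hb hAA hBB hBA
  have h := (finrank_endAlgRat_eq_two_mul_sq_iff_exists_isIsogenous_ellipticPow_cm Ψ (by omega)).1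
    (by rw [h8, hg]; norm_num)
  rwa [hg] at h

/-- **… hence of maximal Picard number: `ρ(X) = 4`** (`ρ = g²` iff `X ∼ E_τ^g` with CM, Lange's Exercise
2.6.3 (2) (i) ⟺ (ii)). [cite: Lange2023AbelianVarietiesComplex, §2.6.3 Exercise (2) (i) ⟺ (ii)]
[cite: HulekLaface2019PicardNumbersAV, §5.1 Prop. 5.1, proof of case (1)] -/
theorem finrank_neronSeveriGroup_eq_four_of_definiteQuaternion_mem_endAlgRat (hη : IsRiemannForm Ψ η)
    (hg : finrank ℂ E = 2) {A B : Matrix κ κ ℚ} (hA : A ∈ endAlgRat Ψ) (hB : B ∈ endAlgRat Ψ) {a b : ℚ}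
    (ha : a < 0) (hb : b < 0) (hAA : A * A = a • (1 : Matrix κ κ ℚ)) (hBB : B * B = b • (1 : Matrix κ κ ℚ))
    (hBA : B * A = -(A * B)) : finrank ℤ (neronSeveriGroup Ψ) = 4 := by
  obtain ⟨τ, hτ, hcm, hiso⟩ :=
    exists_isIsogenous_ellipticPow_cm_of_definiteQuaternion_mem_endAlgRat hη hg hA hB ha hb hAA hBB hBA
  have h := (finrank_neronSeveriGroup_eq_sq_iff_exists_isIsogenous_ellipticPow_cm Ψ (by omega)).2
    ⟨τ, hτ, hcm, by rwa [hg]⟩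
  rw [h, hg]; norm_num

end Structure

/-! ## §4 The converse: squares of CM elliptic curves carry definite quaternion multiplication -/

section Converse

open Literature.RingTheory.CentralSimple Literature.NumberTheory.Automorphic NumberField

/-- A `ℚ`-algebra map transports a quaternion pair `A² = a`, `B² = b`, `BA = -AB`. [folklore] -/
private theorem qb_map {R R' : Type*} [Ring R] [Algebra ℚ R] [Ring R'] [Algebra ℚ R'] (f : R →ₐ[ℚ] R')
    {α β : R} {a b : ℚ} (hαα : α * α = a • (1 : R)) (hββ : β * β = b • (1 : R)) (hβα : β * α = -(α * β)) :
    f α * f α = a • (1 : R') ∧ f β * f β = b • (1 : R') ∧ f β * f α = -(f α * f β) := by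
  refine ⟨?_, ?_, ?_⟩ <;> simp only [← map_mul, hαα, hββ, hβα, map_smul, map_one, map_neg]

/-- **`√(p² - 4q) ∈ End_ℚ(E_τ)` for a CM curve** (`τ² + pτ + q = 0` over `ℚ`): the rational matrix of
multiplication by `2τ + p` on the lattice basis `(τ, 1)` lies in `End_ℚ(E_τ)` and squares to `(p² - 4q)·1`
with `p² - 4q = -4 (Im τ)² < 0`. [cite: Lange2023AbelianVarietiesComplex, §5.1.5 Exercise (1) (complex multiplication by `τ`, the tree's `tauMul_mem_endAlgRat`)] -/
private theorem exists_mem_endAlgRat_ellipticPeriod_mul_self_eq_smul {τ : ℂ} (hτ : τ.im ≠ 0)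
    (hcm : ellipticEnd hτ ≠ ⊥) :
    ∃ W ∈ endAlgRat (ellipticPeriod hτ), ∃ d : ℚ, d < 0 ∧ W * W = d • (1 : Matrix (Fin 2) (Fin 2) ℚ) := by
  obtain ⟨p, q, hq⟩ := (ellipticEnd_ne_bot_iff hτ).1 hcm
  -- `W = 2·(τ-multiplication) + p·1`, the multiplication by `2τ + p`
  refine ⟨(2 : ℚ) • !![-p, 1; -q, 0] + p • (1 : Matrix (Fin 2) (Fin 2) ℚ),
    Subalgebra.add_mem _ (Subalgebra.smul_mem _ (tauMul_mem_endAlgRat hτ hq) 2)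
      (Subalgebra.smul_mem _ (Subalgebra.one_mem _) p), p ^ 2 - 4 * q, ?_, ?_⟩
  · have hre := congrArg Complex.re hq
    have him := congrArg Complex.im hq
    simp only [sq, Complex.add_re, Complex.mul_re, Complex.ratCast_re, Complex.ratCast_im, zero_mul, sub_zero,
      Complex.zero_re, Complex.add_im, Complex.mul_im, add_zero, Complex.zero_im] at hre him
    have h2 : 2 * τ.re + p = 0 := by
      have : τ.im * (2 * τ.re + p) = 0 := by linear_combination him
      exact (mul_eq_zero.1 this).resolve_left hτ
    have hpos : 0 < τ.im * τ.im := mul_self_pos.2 hτ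
    have : ((p ^ 2 - 4 * q : ℚ) : ℝ) < 0 := by
      push_cast
      nlinarith
    exact_mod_cast this
  · ext i j
    fin_cases i <;> fin_cases j <;> simp [Matrix.mul_apply, Fin.sum_univ_two, Matrix.one_apply] <;> ring

variable {κ : Type} [Fintype κ] [DecidableEq κ] [Nonempty κ] {E : Type*} [NormedAddCommGroup E]
  [NormedSpace ℂ E] [FiniteDimensional ℂ E] {Ψ : (κ → ℝ) ≃L[ℝ] E} {η : E [⋀^Fin 2]→L[ℝ] ℝ}

omit [Nonempty κ] [FiniteDimensional ℂ E] in
/-- **A torus isogenous to the square of a CM elliptic curve has definite quaternion multiplication**: if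
`X ∼ E_τ × E_τ` with `End(E_τ) ≠ ℤ` (`τ² + pτ + q = 0` over `ℚ`), then `End_ℚ(X) ≅ M₂(End_ℚ(E_τ))`
contains `A = diag(w, -w)`, `B = (0 1; -1 0)` with `w = √(p² - 4q) ∈ End_ℚ(E_τ)`: `A² = p² - 4q < 0`,
`B² = -1`, `BA = -AB` — the definite quaternion algebra `(p² - 4q, -1 / ℚ)`.
[cite: Lange2023AbelianVarietiesComplex, §5.1.5 Exercise (2)(a)(ii) (`End_ℚ(E₁ × E₂) ≃ M₂(End_ℚ(E₁))` for `E₁ ∼ E₂`) and §2.4.4 Cor. 2.4.26]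
[cite: HulekLaface2019PicardNumbersAV, §5.1 Prop. 5.1, case (1) (the excluded structure realised on `Y²`)] -/
theorem IsIsogenous.exists_definiteQuaternion_mem_endAlgRat {τ : ℂ} {hτ : τ.im ≠ 0}
    (h : IsIsogenous Ψ (powPeriod (ellipticPeriod hτ) 2)) (hcm : ellipticEnd hτ ≠ ⊥) :
    ∃ A B : Matrix κ κ ℚ, A ∈ endAlgRat Ψ ∧ B ∈ endAlgRat Ψ ∧ ∃ a b : ℚ, a < 0 ∧ b < 0 ∧
      A * A = a • (1 : Matrix κ κ ℚ) ∧ B * B = b • (1 : Matrix κ κ ℚ) ∧ B * A = -(A * B) := by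
  obtain ⟨W, hW, d, hd, hWW⟩ := exists_mem_endAlgRat_ellipticPeriod_mul_self_eq_smul hτ hcm
  set w : endAlgRat (ellipticPeriod hτ) := ⟨W, hW⟩ with hwdef
  have hww : w * w = d • (1 : endAlgRat (ellipticPeriod hτ)) := Subtype.ext hWW
  -- the pair `A = diag(w, -w)`, `B = (0 1; -1 0)` in `M₂(End_ℚ(E_τ))`
  set α : Matrix (Fin 2) (Fin 2) (endAlgRat (ellipticPeriod hτ)) := !![w, 0; 0, -w] with hαdef
  set β : Matrix (Fin 2) (Fin 2) (endAlgRat (ellipticPeriod hτ)) := !![0, 1; -1, 0] with hβdef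
  have hαα : α * α = d • (1 : Matrix (Fin 2) (Fin 2) (endAlgRat (ellipticPeriod hτ))) := by
    ext i j : 2
    fin_cases i <;> fin_cases j <;>
      simp [hαdef, hwdef, Matrix.mul_apply, Fin.sum_univ_two, hWW, Matrix.smul_apply]
  have hββ : β * β = (-1 : ℚ) • (1 : Matrix (Fin 2) (Fin 2) (endAlgRat (ellipticPeriod hτ))) := by
    ext i j : 2
    fin_cases i <;> fin_cases j <;> simp [hβdef, Matrix.mul_apply, Fin.sum_univ_two]
  have hβα : β * α = -(α * β) := by
    ext i j : 2
    fin_cases i <;> fin_cases j <;> simp [hαdef, hβdef, Matrix.mul_apply, Fin.sum_univ_two]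
  -- transport along `M₂(End_ℚ(E_τ)) ≃ End_ℚ(E_τ²) ≃ End_ℚ(X)`
  obtain ⟨f⟩ := h.nonempty_endAlgRatEquiv
  let g : Matrix (Fin 2) (Fin 2) (endAlgRat (ellipticPeriod hτ)) →ₐ[ℚ] endAlgRat Ψ :=
    (f.symm : endAlgRat (powPeriod (ellipticPeriod hτ) 2) →ₐ[ℚ] endAlgRat Ψ).comp
      (endAlgRatPowEquiv (ellipticPeriod hτ) 2 : _ →ₐ[ℚ] endAlgRat (powPeriod (ellipticPeriod hτ) 2))
  obtain ⟨h1, h2, h3⟩ := qb_map g hαα hββ hβα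
  exact ⟨g α, g β, (g α).2, (g β).2, d, -1, hd, by norm_num, congrArg Subtype.val h1, congrArg Subtype.val h2,
    congrArg Subtype.val h3⟩

/-- **Characterisation of abelian surfaces with definite quaternion multiplication.**  For a polarised
complex torus `X` of dimension `2`: `End_ℚ(X)` contains a definite quaternion algebra `ℚ⟨A, B⟩`
(`A² = a`, `B² = b`, `BA = -AB`, `a, b < 0`) iff `X` is isogenous to `E_τ × E_τ` for an elliptic curve
`E_τ` with complex multiplication. [cite: HulekLaface2019PicardNumbersAV, §5.1 Prop. 5.1, case (1) and its proof («`X` is isogenous to a square `Y²`»)]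
[cite: Shimura1963AnalyticFamilies, §4 (via Hulek–Laface)] [cite: Lange2023AbelianVarietiesComplex, §2.6.3 Exercise (2), §5.1.5 Exercise (2)] -/
theorem IsRiemannForm.exists_definiteQuaternion_mem_endAlgRat_iff (hη : IsRiemannForm Ψ η)
    (hg : finrank ℂ E = 2) :
    (∃ A B : Matrix κ κ ℚ, A ∈ endAlgRat Ψ ∧ B ∈ endAlgRat Ψ ∧ ∃ a b : ℚ, a < 0 ∧ b < 0 ∧
        A * A = a • (1 : Matrix κ κ ℚ) ∧ B * B = b • (1 : Matrix κ κ ℚ) ∧ B * A = -(A * B)) ↔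
      ∃ τ : ℂ, ∃ hτ : τ.im ≠ 0, ellipticEnd hτ ≠ ⊥ ∧ IsIsogenous Ψ (powPeriod (ellipticPeriod hτ) 2) := by
  constructor
  · rintro ⟨A, B, hA, hB, a, b, ha, hb, hAA, hBB, hBA⟩
    exact exists_isIsogenous_ellipticPow_cm_of_definiteQuaternion_mem_endAlgRat hη hg hA hB ha hb hAA hBB hBA
  · rintro ⟨τ, hτ, hcm, h⟩
    exact h.exists_definiteQuaternion_mem_endAlgRat hcm

/-- **… iff `ρ(X) = 4`** (maximal Picard number). [cite: Lange2023AbelianVarietiesComplex, §2.6.3 Exercise (2) (i) ⟺ (ii)]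
[cite: HulekLaface2019PicardNumbersAV, §5.1 Prop. 5.1, case (1)] -/
theorem IsRiemannForm.exists_definiteQuaternion_mem_endAlgRat_iff_finrank_neronSeveriGroup_eq_four
    (hη : IsRiemannForm Ψ η) (hg : finrank ℂ E = 2) :
    (∃ A B : Matrix κ κ ℚ, A ∈ endAlgRat Ψ ∧ B ∈ endAlgRat Ψ ∧ ∃ a b : ℚ, a < 0 ∧ b < 0 ∧
        A * A = a • (1 : Matrix κ κ ℚ) ∧ B * B = b • (1 : Matrix κ κ ℚ) ∧ B * A = -(A * B)) ↔
      finrank ℤ (neronSeveriGroup Ψ) = 4 := by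
  rw [hη.exists_definiteQuaternion_mem_endAlgRat_iff hg,
    show (4 : ℕ) = (finrank ℂ E) ^ 2 by rw [hg]; norm_num,
    finrank_neronSeveriGroup_eq_sq_iff_exists_isIsogenous_ellipticPow_cm Ψ (by omega), hg]

/-- **… iff `dim_ℚ End_ℚ(X) = 8`** (maximal endomorphism rank). [cite: Beauville2014MaximalPicard, §3 Prop. 3]
[cite: HulekLaface2019PicardNumbersAV, §5.1 Prop. 5.1, case (1)] -/
theorem IsRiemannForm.exists_definiteQuaternion_mem_endAlgRat_iff_finrank_endAlgRat_eq_eight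
    (hη : IsRiemannForm Ψ η) (hg : finrank ℂ E = 2) :
    (∃ A B : Matrix κ κ ℚ, A ∈ endAlgRat Ψ ∧ B ∈ endAlgRat Ψ ∧ ∃ a b : ℚ, a < 0 ∧ b < 0 ∧
        A * A = a • (1 : Matrix κ κ ℚ) ∧ B * B = b • (1 : Matrix κ κ ℚ) ∧ B * A = -(A * B)) ↔
      finrank ℚ (endAlgRat Ψ) = 8 := by
  rw [hη.exists_definiteQuaternion_mem_endAlgRat_iff hg,
    show (8 : ℕ) = 2 * (finrank ℂ E) ^ 2 by rw [hg]; norm_num,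
    finrank_endAlgRat_eq_two_mul_sq_iff_exists_isIsogenous_ellipticPow_cm Ψ (by omega), hg]

end Converse

end ComplexTorus

end Literature.Geometry.Kaehler
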